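import Literature.AlgebraicGeometry.ProjectiveGeometry.AmpleLocusOpen
import HarnessLib

/-!
# A relative embedding spreads off one fibre (cf. [EGAIII1] Thm. 4.7.1): a fibre embedded by its own sections of a line bundle `E`, with
# `H¹`-type vanishing there, has an AFFINE OPEN NEIGHBOURHOOD in the base over which global sections of `E` embed the WHOLE family

Topic `AlgebraicGeometry/ProjectiveGeometry`; namespace `Literature.AlgebraicGeometry.Morphisms`.  THEOREMS ONLY (no definition, no named fact,
no instance, no notation, no `sorry`); universe `Scheme.{0}`.  Cell `hodgecm-mathlib` (D-0151), P6 «MOD programme», organ «REL-EMB-SPREAD» FILE 1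
(LEAD F0P6-plan (g2) 2026-09-01 22:51:15Z (2)(F1), 22:52:19Z; spec A-p14 (g34) SP3-a2 census 485f21e1 §0 (F1), binder (I-EMB); B-p10 (g29)).
The CHART form of ★ `AmpleLocusOpen.exists_opens_forall_fibre_isClosedImmersion_toProj` (which kept only the fibrewise embeddings): over a
locally Noetherian base the RELATIVE closed immersion `X|_V ↪ ℙ^m_V` over an affine open `V ∋ x` is exposed.  Consumer: the abelian-scheme
reading `AbelianSchemes/PolarizedAbelianSchemeLocalEmbedding` (char-`0` Lefschetz fibre ⇒ embedding over a Zariski open of a MIXED-characteristic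
base), feeding the (I-EMB) binder of `Lines/F0_P6a_IsomSchemeFiniteType`.  Count-neutral: HC_CM is proved only modulo the printed citations until
rung 0 closes — nothing here bears on a summit.

* **`exists_affineOpen_isClosedImmersion_toProj`** — `T` locally Noetherian, `f : X → T` PROPER and FLAT, `E` with a rank-one frame system `F`,
  `x ∈ T`; if over ONE field-valued point `x_K : Spec K → T` centred at `x` the fibre `X₁` (any cartesian square) has `Ext¹(𝒪_{X₁}, E|_{X₁}) = 0`
  and is embedded into `ℙⁿ_K` by finitely many of its own sections of `E|_{X₁}`, THEN there are a Noetherian ring `R` and an affine OPEN IMMERSION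
  `ι : Spec R → T` through `x` such that for EVERY cartesian square `X′ = X ×_T Spec R` (`i′`, `f′`) finitely many sections `b_j` of `E|_{X′}`
  generate it and define a CLOSED IMMERSION `X′ ↪ ℙ^m_R` over `Spec R` (read in the frames `F|_{X′}`; `𝒪(1)` pulls back to `E|_{X′}` by ★
  `nonempty_twistMod_toProj_iso`).  Proof: an affine Noetherian chart `Spec Γ(T, V) ∋ x`, ★ `AmpleLocusOpenAffine.exists_opens_forall_isClosedImmersion_toProj_of_fieldExtension`
  (global sections `b` over the chart + an open `U₀ ∋ 𝔭` over which they embed every ring-valued fibre), a basic open `D(s) ⊆ U₀` through `𝔭`,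
  and the RING-valued point `Spec Γ(T, V)_s → Spec Γ(T, V)` (the reason FILE 1's `K′` is any commutative ring): the family over `D(s)` IS a fibre.

## References
* [EGAIII1] A. Grothendieck, J. Dieudonné, *EGA III₁*, Publ. Math. IHÉS 11 (1961), Thm. (4.7.1) (p. 145), Prop. (4.6.7) (ii).
* [GortzWedhorn2023] U. Görtz, T. Wedhorn, *Algebraic Geometry II* (2023), Thm. 24.46 (p. 397).
* [Hartshorne1977] R. Hartshorne, *Algebraic Geometry* (1977), II Thm. 7.1 (p. 150), III Thm. 12.11 (p. 290).
* [StacksProject] The Stacks Project, Tags 0D2N, 0D2S.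
-/

noncomputable section

-- `TopCat.Presheaf`/`Scheme.Modules` and pull-back bookkeeping (as in ★ `ProjectiveGeometry/AmpleLocusOpen`).
set_option backward.isDefEq.respectTransparency false

open CategoryTheory CategoryTheory.Limits CategoryTheory.Abelian AlgebraicGeometry TopologicalSpace Opposite
open Literature.AlgebraicGeometry.Modules
open Literature.AlgebraicGeometry.Motives Literature.AlgebraicGeometry.Motives.GeneratingSections

namespace Literature.AlgebraicGeometry.Morphisms

/-- `Ext`-vanishing transports along an isomorphism of the second argument. [folklore] -/
private theorem subsingleton_ext_of_iso₃ {C : Type*} [Category C] [Abelian C] [HasExt.{1} C] (P : C) {Y Y' : C}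
    (e : Y ≅ Y') (i : ℕ) (h : Subsingleton (Ext.{1} P Y' i)) : Subsingleton (Ext.{1} P Y i) := by
  refine subsingleton_of_forall_eq 0 fun x => ?_
  have hx : x = (x.comp (Ext.mk₀ e.hom) (add_zero i)).comp (Ext.mk₀ e.inv) (add_zero i) := by
    rw [Ext.comp_assoc_of_second_deg_zero, Ext.mk₀_comp_mk₀, e.hom_inv_id, Ext.comp_mk₀_id]
  rw [hx, Subsingleton.elim (x.comp (Ext.mk₀ e.hom) (add_zero i)) 0, Ext.zero_comp]

/-- **A field-valued point of `Spec A` centred at `𝔭` factors through `Spec κ(𝔭)`** (Mathlib `Ideal.ResidueField.lift`). [folklore] -/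
private theorem exists_eq_specMap_comp_residueField' {A : Type} [CommRing A] {K : Type} [Field K]
    (y : Spec (.of K) ⟶ Spec (.of A)) (𝔭 : PrimeSpectrum A) (hy : y (IsLocalRing.closedPoint K) = 𝔭) :
    ∃ φ : 𝔭.asIdeal.ResidueField →+* K,
      y = Spec.map (CommRingCat.ofHom φ) ≫ Spec.map (CommRingCat.ofHom (algebraMap A 𝔭.asIdeal.ResidueField)) := by
  obtain ⟨ψ, rfl⟩ := Spec.map_surjective y
  have hker : RingHom.ker ψ.hom = 𝔭.asIdeal := by
    rw [← hy]
    change RingHom.ker ψ.hom = Ideal.comap ψ.hom (IsLocalRing.maximalIdeal K)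
    rw [IsLocalRing.isField_iff_maximalIdeal_eq.mp (Field.toIsField K), RingHom.ker_eq_comap_bot]
  have hunit : 𝔭.asIdeal.primeCompl ≤ (IsUnit.submonoid K).comap ψ.hom := fun a ha ↦ by
    change IsUnit (ψ.hom a)
    refine isUnit_iff_ne_zero.mpr fun h0 ↦ ha ?_
    rw [← hker]
    exact h0
  refine ⟨Ideal.ResidueField.lift 𝔭.asIdeal ψ.hom hker.ge hunit, ?_⟩
  rw [← Spec.map_comp, ← CommRingCat.ofHom_comp]
  congr 1
  ext a
  change ψ.hom a = Ideal.ResidueField.lift 𝔭.asIdeal ψ.hom hker.ge hunit (algebraMap A 𝔭.asIdeal.ResidueField a)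
  rw [Ideal.ResidueField.lift_algebraMap]

section Chart

variable {T X : Scheme.{0}} [IsLocallyNoetherian T] (f : X ⟶ T) [IsProper f] [Flat f]
  {E : X.Modules} (F : FrameSystem E) (h1 : ∀ x, F.rank x = 1) (x : T)
  {K : Type} [Field K] (xK : Spec (.of K) ⟶ T) (hx : x ∈ Set.range xK)
  {X₁ : Scheme.{0}} {i₁ : X₁ ⟶ X} {f₁ : X₁ ⟶ Spec (.of K)} (H₁ : IsPullback i₁ f₁ f xK)
  (hvan : Subsingleton (Ext.{1} (unitModule X₁) ((Scheme.Modules.pullback i₁).obj E) 1))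
  (h1₁ : ∀ x, (F.pullback i₁).rank x = 1) {n : ℕ} (s : Fin (n + 1) → Γ((Scheme.Modules.pullback i₁).obj E, ⊤))
  (hcov : ⨆ i, ⨆ x, X₁.basicOpen ((CocycleSections.ofFrameSystem (F.pullback i₁) h1₁ s).coeff i x) = ⊤)
  (H : IsClosedImmersion ((ofCocycleSections (F.pullback i₁).U
    (CocycleSections.ofFrameSystem (F.pullback i₁) h1₁ s) hcov).toProj f₁))

include hx H₁ hvan H in
/-- **A RELATIVE EMBEDDING SPREADS OFF ONE FIBRE TO AN AFFINE OPEN OF THE BASE** (cf. [EGAIII1] Thm. (4.7.1); the chart form of ★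
`exists_opens_forall_fibre_isClosedImmersion_toProj`).  `T` locally Noetherian, `f : X → T` PROPER and FLAT, `E` an `𝒪_X`-module with a rank-one
frame system `F`, `x ∈ T`; IF over ONE field-valued point `x_K : Spec K → T` centred at `x` the fibre `X₁` (ANY cartesian square) has
`Ext¹(𝒪_{X₁}, E|_{X₁}) = 0` and is embedded into `ℙⁿ_K` by finitely many of its own sections of `E|_{X₁}` generating it, THEN there are a
Noetherian ring `R` and an affine OPEN IMMERSION `ι : Spec R → T` with `x ∈ ι(Spec R)` such that for EVERY cartesian square
`X′ = X ×_T Spec R` (`i′ : X′ → X`, `f′ : X′ → Spec R`) there are finitely many sections `b₀, …, b_m` of `E|_{X′}` generating it whose morphism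
`X′ → ℙ^m_R` over `Spec R` (read in the frames `F|_{X′}`) is a CLOSED IMMERSION.  (`R = Γ(T, V)_s` for an affine open `V ∋ x` and a basic open
`D(s) ∋ x` inside the open of ★ `exists_opens_forall_isClosedImmersion_toProj_of_fieldExtension`, applied to the RING-valued point
`Spec Γ(T, V)_s → Spec Γ(T, V)`.)
[cite: EGAIII1, Thm. (4.7.1) p. 145] [cite: GortzWedhorn2023, Thm. 24.46 (p. 397)] [cite: Hartshorne1977, II Thm. 7.1 (p. 150)] -/
theorem exists_affineOpen_isClosedImmersion_toProj :
    ∃ (R : Type) (_ : CommRing R) (_ : IsNoetherianRing R) (ι : Spec (.of R) ⟶ T) (_ : IsOpenImmersion ι), x ∈ Set.range ι ∧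
      ∀ {X' : Scheme.{0}} (i' : X' ⟶ X) (f' : X' ⟶ Spec (.of R)), IsPullback i' f' f ι →
        ∃ (m : ℕ) (b : Fin (m + 1) → Γ((Scheme.Modules.pullback i').obj E, ⊤))
          (hcov' : ⨆ i, ⨆ z, X'.basicOpen ((CocycleSections.ofFrameSystem (F.pullback i') (fun z ↦ h1 (i'.base z))
            b).coeff i z) = ⊤),
          IsClosedImmersion ((ofCocycleSections (F.pullback i').U (CocycleSections.ofFrameSystem (F.pullback i')
            (fun z ↦ h1 (i'.base z)) b) hcov').toProj f') := by
  -- Step 0: an affine Noetherian chart `ιV : Spec Γ(T, V) → T` through `x`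
  obtain ⟨_, ⟨V, hV, rfl⟩, hxV, -⟩ := T.isBasis_affineOpens.exists_subset_of_mem_open (Set.mem_univ x) isOpen_univ
  haveI : IsNoetherianRing Γ(T, V) := IsLocallyNoetherian.component_noetherian ⟨V, hV⟩
  let ιV : Spec Γ(T, V) ⟶ T := hV.fromSpec
  have hrange : Set.range ιV = (V : Set T) := hV.range_fromSpec
  let XV : Scheme.{0} := pullback f ιV
  let jV : XV ⟶ X := pullback.fst f ιV
  let fV : XV ⟶ Spec Γ(T, V) := pullback.snd f ιV
  have HV : IsPullback jV fV f ιV := IsPullback.of_hasPullback f ιV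
  haveI : IsProper fV := MorphismProperty.pullback_snd (P := @IsProper) f ιV inferInstance
  haveI : Flat fV := MorphismProperty.pullback_snd (P := @Flat) f ιV inferInstance
  -- the prime `𝔭` under `x` and the point `x_K` read over the chart, through `κ(𝔭)`
  obtain ⟨𝔭, h𝔭⟩ : x ∈ Set.range ιV := by rw [hrange]; exact hxV
  have hxK : ∀ p, xK p = x := fun p ↦ by
    obtain ⟨q, hq⟩ := hx
    rw [Subsingleton.elim p q, hq]
  have hsub : Set.range xK ⊆ Set.range ιV := by
    rintro _ ⟨p, rfl⟩
    rw [hxK, ← h𝔭]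
    exact ⟨𝔭, rfl⟩
  let xK' : Spec (.of K) ⟶ Spec Γ(T, V) := IsOpenImmersion.lift ιV xK hsub
  have hxK' : xK' ≫ ιV = xK := IsOpenImmersion.lift_fac ιV xK hsub
  have hpt : xK' (IsLocalRing.closedPoint K) = 𝔭 := by
    apply ιV.isOpenEmbedding.injective
    rw [← Scheme.Hom.comp_apply, hxK', hxK, h𝔭]
  obtain ⟨φ, hφ⟩ := exists_eq_specMap_comp_residueField' xK' 𝔭 hpt
  -- the fibre `X₁` over the chart
  let i₁' : X₁ ⟶ XV := HV.lift i₁ (f₁ ≫ xK') (by rw [Category.assoc, hxK']; exact H₁.w)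
  have hi₁' : i₁' ≫ jV = i₁ := HV.lift_fst _ _ _
  have H₁' : IsPullback i₁' f₁ fV
      (Spec.map (CommRingCat.ofHom φ) ≫ Spec.map (CommRingCat.ofHom (algebraMap Γ(T, V) 𝔭.asIdeal.ResidueField))) := by
    rw [← hφ]
    exact IsPullback.of_right (by rw [hi₁', hxK']; exact H₁) (HV.lift_snd _ _ _) HV
  -- the module `E|_{X_V}`, its frames, and the fibre data transported to the model `i₁'^* jV^* E ≅ i₁^* E`
  let EV : XV.Modules := (Scheme.Modules.pullback jV).obj E
  let FV : FrameSystem EV := F.pullback jV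
  have h1V : ∀ z, FV.rank z = 1 := fun z ↦ h1 (jV.base z)
  let Φ : (Scheme.Modules.pullback i₁').obj EV ≅ (Scheme.Modules.pullback i₁).obj E :=
    (Scheme.Modules.pullbackComp i₁' jV).app E ≪≫ (Scheme.Modules.pullbackCongr hi₁').app E
  have hvan' : Subsingleton (Ext.{1} (unitModule X₁) ((Scheme.Modules.pullback i₁').obj EV) 1) :=
    subsingleton_ext_of_iso₃ (unitModule X₁) Φ 1 hvan
  have h1₁' : ∀ z, (FV.pullback i₁').rank z = 1 := fun z ↦ h1 _
  obtain ⟨hcov₁, e₁⟩ := ofCocycleSections_ofFrameSystem_eq_of_iso Φ.symm (F.pullback i₁) (FV.pullback i₁') h1₁ h1₁' s hcov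
  have H' : IsClosedImmersion ((ofCocycleSections (FV.pullback i₁').U (CocycleSections.ofFrameSystem (FV.pullback i₁') h1₁'
      (fun j ↦ Φ.symm.hom.app ⊤ (s j))) hcov₁).toProj f₁) := by
    rw [← e₁]; exact H
  -- Step 1: the affine-base theorem over the chart: global sections `b` and the open `U₀ ∋ 𝔭`
  obtain ⟨m, b, U₀, h𝔭U₀, hU₀⟩ := exists_opens_forall_isClosedImmersion_toProj_of_fieldExtension fV FV h1V 𝔭 φ H₁' hvan' h1₁'
    (fun j ↦ Φ.symm.hom.app ⊤ (s j)) hcov₁ H'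
  -- Step 2: a basic open `D(t₀) ∋ 𝔭` inside `U₀`, and the RING-valued point `Spec Γ(T, V)_{t₀} → Spec Γ(T, V)`
  obtain ⟨_, ⟨_, ⟨t₀, rfl⟩, rfl⟩, h𝔭t₀, ht₀U₀⟩ :=
    (PrimeSpectrum.isBasis_basic_opens (R := Γ(T, V))).exists_subset_of_mem_open h𝔭U₀ U₀.isOpen
  let R : Type := Localization.Away t₀
  let ιs : Spec (.of R) ⟶ Spec Γ(T, V) := Spec.map (CommRingCat.ofHom (algebraMap Γ(T, V) R))
  have hιs : Set.range ιs = (PrimeSpectrum.basicOpen t₀ : Set (PrimeSpectrum Γ(T, V))) :=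
    PrimeSpectrum.localization_away_comap_range R t₀
  refine ⟨R, inferInstance, inferInstance, ιs ≫ ιV, inferInstance, ?_, fun i' f' Hi' ↦ ?_⟩
  · -- `x = ιV 𝔭` with `𝔭 ∈ D(t₀) = range ιs`
    obtain ⟨q, hq⟩ : 𝔭 ∈ Set.range ιs := by rw [hιs]; exact h𝔭t₀
    exact ⟨q, by rw [Scheme.Hom.comp_apply, hq, h𝔭]⟩
  -- the given square over `ιs ≫ ιV` sits over the chart by a square over `ιs`
  let h : _ ⟶ XV := HV.lift i' (f' ≫ ιs) (by rw [Category.assoc]; exact Hi'.w)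
  have hh : h ≫ jV = i' := HV.lift_fst _ _ _
  have Hh : IsPullback h f' fV ιs := IsPullback.of_right (by rw [hh]; exact Hi') (HV.lift_snd _ _ _) HV
  have hrangeU₀ : Set.range ιs ⊆ (U₀ : Set _) := by rw [hιs]; exact ht₀U₀
  obtain ⟨hcovy, Hy'⟩ := hU₀ R ιs hrangeU₀ h f' Hh
  -- Step 3: read the embedding in the model `i'^* E ≅ h^* jV^* E` and the frames `F|_{X'}`
  let Ψ : (Scheme.Modules.pullback h).obj EV ≅ (Scheme.Modules.pullback i').obj E :=
    (Scheme.Modules.pullbackComp h jV).app E ≪≫ (Scheme.Modules.pullbackCongr hh).app E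
  have h1y : ∀ z, (F.pullback i').rank z = 1 := fun z ↦ h1 (i'.base z)
  obtain ⟨hcov', e'⟩ := ofCocycleSections_ofFrameSystem_eq_of_iso Ψ (FV.pullback h) (F.pullback i') (fun z ↦ h1V (h.base z))
    h1y (fun j ↦ unitSectionLE h EV (V := ⊤) (U := ⊤) le_top (b j)) hcovy
  refine ⟨m, fun j ↦ Ψ.hom.app ⊤ (unitSectionLE h EV (V := ⊤) (U := ⊤) le_top (b j)), hcov', ?_⟩
  rw [← e']
  exact Hy'

end Chart

end Literature.AlgebraicGeometry.Morphisms

end
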